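import Summits.ABC.StewartYu.PadicMulticubicNorm
import Summits.ABC.StewartYu.MultiquadraticLiouvilleExt
import HarnessLib

/-!
# Cell abc-stewartyu, WP-Y2 / `TwoAdicPrincipalCubic`: the `p`-adic Liouville inequality at the
# THIRD points, in an arbitrary ultrametric field

`Summits/ABC/StewartYu/PadicMulticubicLiouville.lean` — cell `abc-stewartyu` (lit seat g3; theorems
only, no definition, no named fact), sequel to `PadicMulticubicNorm.lean`; the `q = 3` twin of
`MultiquadraticLiouvilleExt.lean` (seat p3). `L` is any ultrametric normed field of characteristic
zero with `‖z‖ ≤ 1` on `ℤ` and `‖n‖ ≥ 1/n` on positive integers (e.g. `ℚ₂`, `ℂ₂`); the generators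
are INTEGERS `αⱼ` (in the engine: `qⱼ²`), the roots `tⱼ ∈ L`, `tⱼ³ = αⱼ`, `‖tⱼ‖ ≤ 1`.

Main result (namespace `Summit.ABC.StewartYu.MulticubLiouville`): `norm_ev3_ge` —
`‖∑_l c_l ∏ⱼ tⱼ^{lⱼ}‖ ≥ 1/(6 D M ∏ⱼ max(1,|αⱼ|))^{3^{k+1} − 1}` for `c ≠ 0` with `D c ∈ ℤ`,
`∑|c| ≤ M` (`D, M ≥ 1`) — by induction on `k` exactly as in the `q = 2` files, with
`x · cof(x) = N(x)` (`Multicub.ev3_mul_ev3_cofVec`), `N(x) ≠ 0` (`Multicub.ev3_normVec_ne_zero`),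
`‖cof(x)‖ ≤ D²`, and the induction hypothesis for `N(x)` (denominator `D³`,
`ℓ¹ ≤ 6 max(1,|αₖ|)² Hₖ² M³`). The exponent is crude (the degree of the tower is `3ᵏ`); sharpening
as in `PadicMultiquadraticLiouvilleSharp.lean` is routine. Also: `norm_ev3_le_natCast`
(integrality), `norm_ev3_ge_base`, `cubic_numeric_step` (the three elementary norm facts are `MultiquadExt`'s).
Everything is [folklore]; nothing here is claimed to be in print. WHAT THIS IS NOT: not the
third-point step of the engine itself (the values must first be exhibited as such an `ev3`).
-/

noncomputable section

open Finset

namespace Summit.ABC.StewartYu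

namespace MulticubLiouville

open Multicub
open MultiquadExt (inv_norm_natCast_le norm_natCast_pos inv_abs_le_norm_intCast)

variable {L : Type*} [NormedField L] [IsUltrametricDist L] [CharZero L] {k : ℕ}

omit [IsUltrametricDist L] [CharZero L] in
/-- Integrality of monomials. [folklore] -/
theorem norm_mono3_le_one (t : Fin k → L) (ht1 : ∀ j, ‖t j‖ ≤ 1) (l : Fin k → Fin 3) :
    ‖mono3 t l‖ ≤ 1 := by
  unfold mono3
  rw [norm_prod]
  exact Finset.prod_le_one (fun j _ => norm_nonneg _) fun j _ => by
    rw [norm_pow]; exact pow_le_one₀ (norm_nonneg _) (ht1 j)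

omit [CharZero L] in
/-- Integrality: integer coefficients evaluate to norm `≤ 1`. [folklore] -/
theorem norm_ev3_le_one_of_int (hZ : ∀ z : ℤ, ‖(z : L)‖ ≤ 1) (t : Fin k → L)
    (ht1 : ∀ j, ‖t j‖ ≤ 1) {c : (Fin k → Fin 3) → ℚ} (hint : ∀ l, ∃ z : ℤ, c l = z) :
    ‖ev3 t c‖ ≤ 1 := by
  unfold ev3
  refine IsUltrametricDist.norm_sum_le_of_forall_le_of_nonneg zero_le_one fun l _ => ?_
  obtain ⟨z, hz⟩ := hint l
  rw [norm_mul, hz]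
  have h1 : ‖((z : ℚ) : L)‖ ≤ 1 := by
    rw [Rat.cast_intCast]; exact hZ z
  exact mul_le_one₀ h1 (norm_nonneg _) (norm_mono3_le_one t ht1 l)

/-- A vector `c` with `D c ∈ ℤ` evaluates to an element of norm `≤ D`. [folklore] -/
theorem norm_ev3_le_natCast (hZ : ∀ z : ℤ, ‖(z : L)‖ ≤ 1)
    (hN : ∀ n : ℕ, n ≠ 0 → (n : ℝ)⁻¹ ≤ ‖(n : L)‖) (t : Fin k → L) (ht1 : ∀ j, ‖t j‖ ≤ 1)
    {c : (Fin k → Fin 3) → ℚ} {D : ℕ} (hD : 1 ≤ D) (hden : ∀ l, ∃ z : ℤ, (D : ℚ) * c l = z) :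
    ‖ev3 t c‖ ≤ D := by
  have hD0 : D ≠ 0 := by omega
  have hint : ∀ l, ∃ z : ℤ, ((D : ℚ) • c) l = z := fun l => by
    obtain ⟨z, hz⟩ := hden l; exact ⟨z, by simpa using hz⟩
  have h1 := norm_ev3_le_one_of_int hZ t ht1 hint
  rw [ev3_smul, norm_mul, Rat.cast_natCast] at h1
  have hnorm : 0 < ‖(D : L)‖ := norm_natCast_pos hN hD0
  have h2 : ‖ev3 t c‖ ≤ 1 / ‖(D : L)‖ := by
    rw [le_div_iff₀ hnorm]; linarith [h1]
  exact h2.trans (inv_norm_natCast_le hN hD)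

omit [IsUltrametricDist L] in
/-- The base of the induction (no roots): `c = z/D ≠ 0`, `|c| ≤ M` gives `‖c‖ ≥ 1/(DM)`.
[folklore] -/
theorem norm_ev3_ge_base (hZ : ∀ z : ℤ, ‖(z : L)‖ ≤ 1)
    (hN : ∀ n : ℕ, n ≠ 0 → (n : ℝ)⁻¹ ≤ ‖(n : L)‖) (t : Fin 0 → L) {c : (Fin 0 → Fin 3) → ℚ}
    (hc : c ≠ 0) {D : ℕ} (hD : 1 ≤ D) (hden : ∀ l, ∃ z : ℤ, (D : ℚ) * c l = z) {M : ℝ}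
    (hcM : ∑ l, |(c l : ℝ)| ≤ M) :
    1 / ((D : ℝ) * M) ≤ ‖ev3 t c‖ := by
  obtain ⟨l₀, huniv⟩ : ∃ l₀ : Fin 0 → Fin 3, (univ : Finset (Fin 0 → Fin 3)) = {l₀} :=
    ⟨_, Finset.univ_unique⟩
  have hev : ev3 t c = ((c l₀ : ℚ) : L) := by
    unfold ev3
    rw [huniv, Finset.sum_singleton]
    unfold mono3
    rw [Finset.univ_eq_empty, Finset.prod_empty, mul_one]
  have hc0 : c l₀ ≠ 0 := by
    intro h; apply hc; funext l
    rw [Subsingleton.elim l l₀, h]; rfl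
  obtain ⟨z, hz⟩ := hden l₀
  have hD0 : (D : ℚ) ≠ 0 := by exact_mod_cast (show D ≠ 0 by omega)
  have hz0 : z ≠ 0 := by
    rintro rfl
    rw [Int.cast_zero, mul_eq_zero] at hz
    rcases hz with h | h
    · exact hD0 h
    · exact hc0 h
  have hcz : c l₀ = (z : ℚ) / D := by
    field_simp; rw [mul_comm]; exact hz
  have hcM' : |((c l₀ : ℚ) : ℝ)| ≤ M := by
    have : |((c l₀ : ℚ) : ℝ)| ≤ ∑ l, |(c l : ℝ)| := by
      rw [huniv, Finset.sum_singleton]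
    exact this.trans hcM
  have hDR : (0 : ℝ) < D := by exact_mod_cast (show 0 < D by omega)
  have hzle : |(z : ℝ)| ≤ D * M := by
    have h1 : ((c l₀ : ℚ) : ℝ) = (z : ℝ) / D := by rw [hcz]; push_cast; rfl
    rw [h1, abs_div, abs_of_pos hDR, div_le_iff₀ hDR] at hcM'
    linarith [hcM']
  have hzabs : (0 : ℝ) < |(z : ℝ)| := by
    have : (z : ℝ) ≠ 0 := by exact_mod_cast hz0
    exact abs_pos.mpr this
  have hnormD : ‖(D : L)‖ ≤ 1 := by
    have := hZ (D : ℤ)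
    simpa using this
  have hnormD0 : 0 < ‖(D : L)‖ := norm_natCast_pos hN (show D ≠ 0 by omega)
  have hge : ‖(z : L)‖ ≤ ‖ev3 t c‖ := by
    rw [hev, hcz, Rat.cast_div, Rat.cast_intCast, Rat.cast_natCast, norm_div]
    rw [le_div_iff₀ hnormD0]
    calc ‖(z : L)‖ * ‖(D : L)‖ ≤ ‖(z : L)‖ * 1 :=
          mul_le_mul_of_nonneg_left hnormD (norm_nonneg _)
      _ = ‖(z : L)‖ := mul_one _
  have hz1 : 1 / |(z : ℝ)| ≤ ‖(z : L)‖ := inv_abs_le_norm_intCast hN hz0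
  calc 1 / ((D : ℝ) * M) ≤ 1 / |(z : ℝ)| := one_div_le_one_div_of_le hzabs hzle
    _ ≤ ‖(z : L)‖ := hz1
    _ ≤ ‖ev3 t c‖ := hge

/-- The numeric step of the induction. [folklore] -/
theorem cubic_numeric_step {D M Hk A x y : ℝ} {E : ℕ} (hD : 1 ≤ D) (hM : 1 ≤ M) (hHk : 1 ≤ Hk)
    (hA : 1 ≤ A) (hy : 1 / (6 * D ^ 3 * (6 * A ^ 2 * Hk ^ 2 * M ^ 3) * Hk) ^ E ≤ y) (hxy : y ≤ x * D ^ 2) :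
    1 / (6 * D * M * (Hk * A)) ^ (3 * E + 2) ≤ x := by
  set X : ℝ := 6 * D * M * (Hk * A) with hX
  have hX1 : 1 ≤ X := by
    rw [hX]
    have h1 : 1 ≤ D * M := one_le_mul_of_one_le_of_one_le hD hM
    have h2 : 1 ≤ Hk * A := one_le_mul_of_one_le_of_one_le hHk hA
    nlinarith
  have hX0 : 0 < X := by linarith
  set Y : ℝ := 6 * D ^ 3 * (6 * A ^ 2 * Hk ^ 2 * M ^ 3) * Hk with hY
  have hP0 : 0 ≤ D ^ 3 * M ^ 3 * Hk ^ 3 * A ^ 2 := by positivity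
  have hY0 : 0 < Y := by rw [hY]; positivity
  have hYX : Y ≤ X ^ 3 := by
    have e1 : Y = 36 * (D ^ 3 * M ^ 3 * Hk ^ 3 * A ^ 2) := by rw [hY]; ring
    have e2 : X ^ 3 = (216 * A) * (D ^ 3 * M ^ 3 * Hk ^ 3 * A ^ 2) := by rw [hX]; ring
    rw [e1, e2]
    exact mul_le_mul_of_nonneg_right (by linarith) hP0
  -- `1/X^{3E} ≤ 1/Y^E ≤ y`
  have h1 : 1 / X ^ (3 * E) ≤ y := by
    refine le_trans ?_ hy
    rw [pow_mul]
    exact one_div_le_one_div_of_le (pow_pos hY0 E) (pow_le_pow_left₀ hY0.le hYX E)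
  -- `x ≥ y / D² ≥ 1/(X^{3E} D²) ≥ 1/X^{3E+2}`
  have hD0 : 0 < D := by linarith
  have hDX : D ^ 2 ≤ X ^ 2 := by
    refine pow_le_pow_left₀ hD0.le ?_ 2
    rw [hX]
    have h2 : 1 ≤ M * (Hk * A) :=
      one_le_mul_of_one_le_of_one_le hM (one_le_mul_of_one_le_of_one_le hHk hA)
    nlinarith
  have h2 : 1 / X ^ (3 * E + 2) ≤ 1 / (X ^ (3 * E) * D ^ 2) := by
    rw [pow_add]
    exact one_div_le_one_div_of_le (by positivity) (mul_le_mul_of_nonneg_left hDX (by positivity))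
  refine h2.trans ?_
  rw [div_le_iff₀ (by positivity)]
  have := mul_le_mul_of_nonneg_left hxy (show 0 ≤ X ^ (3 * E) by positivity)
  have h3 : 1 ≤ y * X ^ (3 * E) := by
    rw [div_le_iff₀ (by positivity)] at h1; linarith
  nlinarith

set_option maxHeartbeats 800000 in
/-- **The multicubic Liouville inequality in an arbitrary ultrametric field `L` whose norm is
`p`-adic on `ℤ`.** Let `αⱼ ∈ ℤ` (`j < k`) be such that no `∏ αⱼ^{κⱼ}` with some `κⱼ ≢ 0 (mod 3)` is
a rational cube, and let `tⱼ ∈ L` satisfy `tⱼ³ = αⱼ`, `‖tⱼ‖ ≤ 1`. If `c ≠ 0`, `D c_l ∈ ℤ` for all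
`l` and `∑ |c_l| ≤ M` (`D, M ≥ 1`), then
`‖∑_l c_l ∏ⱼ tⱼ^{lⱼ}‖ ≥ 1 / (6 D M ∏ⱼ max(1,|αⱼ|))^{3^{k+1} − 1}`.
Proof: induction on `k`; `x · cof(x) = N(x)` (`ev3_mul_ev3_cofVec`) with `N(x) ≠ 0`
(`ev3_normVec_ne_zero`, lit's norm-form lemma) replaces `x x̄ = u² − αv²` of the `q = 2` files;
`‖cof(x)‖ ≤ D²`, and the induction hypothesis applies to `N(x)` (denominator `D³`,
`ℓ¹ ≤ 6 max(1,|αₖ|)² (∏_{j<k} max(1,|αⱼ|))² M³`). [folklore] -/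
theorem norm_ev3_ge (hZ : ∀ z : ℤ, ‖(z : L)‖ ≤ 1)
    (hN : ∀ n : ℕ, n ≠ 0 → (n : ℝ)⁻¹ ≤ ‖(n : L)‖) : ∀ (k : ℕ) (α : Fin k → ℚ),
    (∀ j, ∃ a : ℤ, α j = a) →
    (∀ κ : Fin k → ℕ, (∃ j, ¬ 3 ∣ κ j) → ∀ γ : ℚ, ∏ j, α j ^ κ j ≠ γ ^ 3) →
    ∀ (t : Fin k → L), (∀ j, t j ^ 3 = (α j : L)) → (∀ j, ‖t j‖ ≤ 1) →
    ∀ (c : (Fin k → Fin 3) → ℚ), c ≠ 0 → ∀ (D : ℕ), 1 ≤ D → (∀ l, ∃ z : ℤ, (D : ℚ) * c l = z) →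
    ∀ (M : ℝ), 1 ≤ M → ∑ l, |(c l : ℝ)| ≤ M →
    1 / (6 * (D : ℝ) * M * ∏ j, max 1 |(α j : ℝ)|) ^ (3 ^ (k + 1) - 1) ≤ ‖ev3 t c‖ := by
  intro k
  induction k with
  | zero =>
    intro α hα hind t ht ht1 c hc D hD hden M hM hcM
    have hbase := norm_ev3_ge_base hZ hN t hc hD hden hcM
    have hP : ∏ j, max 1 |(α j : ℝ)| = 1 := by simp
    rw [hP, mul_one, zero_add, pow_one]
    have hD1 : (1 : ℝ) ≤ D := by exact_mod_cast hD
    have hDM : 1 ≤ (D : ℝ) * M := one_le_mul_of_one_le_of_one_le hD1 hM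
    refine le_trans ?_ hbase
    apply one_div_le_one_div_of_le (by positivity)
    show (D : ℝ) * M ≤ (6 * (D : ℝ) * M) ^ (3 - 1)
    norm_num
    nlinarith
  | succ k ih =>
    intro α' hα' hind t' ht' ht1' c hc D hD hden M hM hcM
    have hM0 : 0 ≤ M := by linarith
    have hD1 : (1 : ℝ) ≤ D := by exact_mod_cast hD
    set a : ℚ := α' (Fin.last k) with ha
    set α : Fin k → ℚ := initα α' with hαdef
    set t : Fin k → L := init3 t' with htdef
    have hα : ∀ j, ∃ z : ℤ, α j = z := fun j => hα' _
    have ht : ∀ j, t j ^ 3 = (α j : L) := init3_pow_three α' t' ht'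
    have ht1 : ∀ j, ‖t j‖ ≤ 1 := fun j => ht1' _
    have hindα := hind_init hind
    set A : ℝ := max 1 |(a : ℝ)| with hA
    set Hk : ℝ := ∏ j, max 1 |(α j : ℝ)| with hHk
    have hA1 : 1 ≤ A := le_max_left _ _
    have hHk1 : 1 ≤ Hk := by
      rw [hHk]
      exact Finset.prod_induction _ (fun x => 1 ≤ x)
        (fun _ _ h1 h2 => one_le_mul_of_one_le_of_one_le h1 h2) le_rfl fun j _ => le_max_left _ _
    have hP' : ∏ j, max 1 |(α' j : ℝ)| = Hk * A := by
      rw [hHk, hA, ha, Fin.prod_univ_castSucc]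
    -- the norm and the cofactor
    set x : L := ev3 t' c with hx
    set N : L := ev3 t (normVec α' c) with hNdef
    set cof : L := ev3 t' (cofVec α' c) with hcof
    have hnorm : x * cof = N := ev3_mul_ev3_cofVec t' ht'
    have hNv0 : normVec α' c ≠ 0 := normVec_ne_zero hind t' ht' hc
    -- the induction hypothesis for `N`
    set D'' : ℕ := D * (D * D) with hD''
    have hD''1 : 1 ≤ D'' := Nat.one_le_iff_ne_zero.mpr (by positivity)
    have hden'' : ∀ l, ∃ z : ℤ, (D'' : ℚ) * normVec α' c l = z := exists_int_normVec hα' hden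
    set M'' : ℝ := 6 * A ^ 2 * Hk ^ 2 * M ^ 3 with hM''
    have hM''1 : 1 ≤ M'' := by
      rw [hM'']
      have h1 : 1 ≤ A ^ 2 * Hk ^ 2 * M ^ 3 :=
        one_le_mul_of_one_le_of_one_le (one_le_mul_of_one_le_of_one_le (one_le_pow₀ hA1)
          (one_le_pow₀ hHk1)) (one_le_pow₀ hM)
      nlinarith
    have hcM'' : ∑ l, |(normVec α' c l : ℝ)| ≤ M'' := sum_abs_normVec_le hM0 hcM
    have key := ih α hα hindα t ht ht1 (normVec α' c) hNv0 D'' hD''1 hden'' M'' hM''1 hcM''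
    -- `‖cof‖ ≤ D²`
    have hDD : 1 ≤ D * D := Nat.one_le_iff_ne_zero.mpr (by positivity)
    have hcof_le : ‖cof‖ ≤ (D : ℝ) ^ 2 := by
      have h := norm_ev3_le_natCast hZ hN t' ht1' hDD (exists_int_cofVec hα' hden)
      rw [hcof]; refine h.trans_eq ?_; push_cast; ring
    have hxyz : ‖N‖ ≤ ‖x‖ * (D : ℝ) ^ 2 := by
      rw [← hnorm, norm_mul]
      exact mul_le_mul_of_nonneg_left hcof_le (norm_nonneg _)
    -- numerics
    have hE : 3 ^ (k + 1 + 1) - 1 = 3 * (3 ^ (k + 1) - 1) + 2 := by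
      have := Nat.one_le_pow (k + 1) 3 (by norm_num)
      rw [pow_succ]; omega
    rw [hP', hE]
    have hD''R : (D'' : ℝ) = (D : ℝ) ^ 3 := by rw [hD'']; push_cast; ring
    rw [hD''R, hM''] at key
    exact cubic_numeric_step hD1 hM hHk1 hA1 key hxyz

end MulticubLiouville

end Summit.ABC.StewartYu

end
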